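import Mathlib
import Summits.ResolutionOfSingularities.ResolutionOfSingularities.Theorems.WeightedInvariantLocalWeightedDropNCResCurveGraphDefs

/-!
# `WeightedInvariant.LocalWeightedDrop`: NC-RESOLUTION SETTINGS for the TOT₂ line (S-SET), part 19 — FINITELY MANY GRAPH BRANCHES divide a
# non-zero series (piece (B1) of the conflict budget of regime (P), graph form)

Crux item stmt-ResolutionOfSingularities-8899 `LocalWeightedDrop` (route `ResolutionOfSingularities/WeightedInvariant`), ENGINE skeleton v33,
regime stub `stub_regimePresented` (P), piece (P3)/(B1) «finiteness of the top-locus branch data» (TOT2-LINE v1.3 §3; owner of (P3) res-type-088).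
[OURS · L1 W4.3 · chain w43 · seat res-L1-w43-stub-1 gen 6; def-free on part 14 (`GraphCurve.onLetter`, `GraphCurve.shear`) and the factoriality of
`k⟦x⟧` (`uniqueFactorizationMonoid_mvPowerSeries`, S-SET …NCResSettingStrict); nothing here is a statement of any manuscript; AI-produced,
gate-checked, weaker than expert review.]

* `prime_X_sub_onLetter` — `x_j − h(x_i)` (`i ≠ j`, `h(0) = 0`) is PRIME in `k⟦x₀,…,x_m⟧` (it is the image of the prime letter `x_j` under the graph-shear
  automorphism, whose inverse is again a graph shear).
* `eq_of_associated_X_sub_onLetter` — distinct graphs give NON-ASSOCIATED primes (kill `x_j ↦ h′(x_i)`).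
* **`finite_graphs_dvd`** — for `A ≠ 0` the set `{h : h(0) = 0, (x_j − h(x_i)) ∣ A}` is FINITE (each is associated to a member of `factors A`).
* **`finite_graphs_dvd_pow_family`** — for a label `A : Fin d → k⟦x⟧` with some `A_{j₀} ≠ 0`, `j₀ < d`, the graphs with
  `(x_j − h(x_i))^{d − l} ∣ A_l` for all `l` are finitely many (the permissible graph curves of a label with non-empty Newton set).
-/

set_option linter.dupNamespace false -- mandated namespace of this single-conjunct summit

noncomputable section

namespace Summit.ResolutionOfSingularities.ResolutionOfSingularities.Theorems

namespace TameFourTupleDrop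

namespace GraphCurve

open MvPowerSeries Literature.AlgebraicGeometry.Resolution

variable {k : Type} [Field k] {m : ℕ}

/-! ## The graph binomial `x_j − h(x_i)` -/

/-- The substitution killing the graph: `x_j ↦ h(x_i)`, other letters fixed. -/
theorem hasSubst_kill {i j : Fin (m + 1)} (h : PowerSeries k) (hh : PowerSeries.constantCoeff h = 0) :
    HasSubst (fun l : Fin (m + 1) => if l = j then onLetter i h else (X l : MvPowerSeries (Fin (m + 1)) k)) :=
  hasSubst_of_constantCoeff_zero fun l => by
    by_cases hl : l = j
    · rw [if_pos hl, constantCoeff_onLetter, hh]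
    · rw [if_neg hl, constantCoeff_X]

/-- Killing the graph annihilates its binomial. -/
theorem subst_kill_X_sub_onLetter {i j : Fin (m + 1)} (hij : i ≠ j) (h : PowerSeries k) (hh : PowerSeries.constantCoeff h = 0) :
    subst (fun l : Fin (m + 1) => if l = j then onLetter i h else (X l : MvPowerSeries (Fin (m + 1)) k)) (X j - onLetter i h) = 0 := by
  have hs := hasSubst_kill (i := i) (j := j) h hh
  rw [← coe_substAlgHom hs, map_sub, coe_substAlgHom, subst_X hs, if_pos rfl, subst_onLetter _ hs, if_neg hij, ← onLetter, sub_self]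

/-- Killing the graph `h′` sends the binomial of `h` to `h′(x_i) − h(x_i)`. -/
theorem subst_kill_X_sub_onLetter' {i j : Fin (m + 1)} (hij : i ≠ j) (h h' : PowerSeries k) (hh' : PowerSeries.constantCoeff h' = 0) :
    subst (fun l : Fin (m + 1) => if l = j then onLetter i h' else (X l : MvPowerSeries (Fin (m + 1)) k)) (X j - onLetter i h) =
      onLetter i h' - onLetter i h := by
  have hs := hasSubst_kill (i := i) (j := j) h' hh'
  rw [← coe_substAlgHom hs, map_sub, coe_substAlgHom, subst_X hs, if_pos rfl, subst_onLetter _ hs, if_neg hij, ← onLetter]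

/-- `onLetter` is injective. -/
theorem onLetter_injective (i : Fin (m + 1)) : Function.Injective (onLetter (k := k) i) := by
  intro h h' heq
  ext n
  have h1 := congrArg (coeff (Finsupp.single i n)) heq
  rwa [coeff_single_onLetter, coeff_single_onLetter] at h1

/-- The binomial as the image of the letter `x_j` under the graph shear with `φ_j = −h`. -/
theorem shear_single_neg_apply {i j : Fin (m + 1)} (hij : i ≠ j) (h : PowerSeries k) :
    shear i (Pi.single j (-h)) j = X j - onLetter i h := by
  rw [shear_of_ne (Ne.symm hij), Pi.single_eq_same, onLetter_neg, sub_eq_add_neg]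

/-- **THE GRAPH BINOMIAL `x_j − h(x_i)` IS PRIME** (`i ≠ j`, `h(0) = 0`): it is the image of the prime `x_j` under the graph shear
`x_j ↦ x_j − h(x_i)`, a ring automorphism of `k⟦x⟧` with inverse the shear by `+h`. -/
theorem prime_X_sub_onLetter {i j : Fin (m + 1)} (hij : i ≠ j) (h : PowerSeries k) (hh : PowerSeries.constantCoeff h = 0) :
    Prime (X j - onLetter i h : MvPowerSeries (Fin (m + 1)) k) := by
  -- the shear `σ` by `φ = single j (−h)` and its inverse `τ` by `−φ`
  set φ : Fin (m + 1) → PowerSeries k := Pi.single j (-h) with hφdef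
  have hφ : ∀ l, l ≠ i → PowerSeries.constantCoeff (φ l) = 0 := by
    intro l _
    by_cases hl : l = j
    · rw [hl, hφdef, Pi.single_eq_same, map_neg, hh, neg_zero]
    · rw [hφdef, Pi.single_eq_of_ne hl, map_zero]
  have hφ' : ∀ l, l ≠ i → PowerSeries.constantCoeff ((-φ) l) = 0 := fun l hl => by rw [Pi.neg_apply, map_neg, hφ l hl, neg_zero]
  have hσ := hasSubst_shear hφ
  have hτ := hasSubst_shear hφ'
  have hF : shear i φ j = X j - onLetter i h := shear_single_neg_apply hij h
  -- `τ ∘ σ = id` and `σ ∘ τ = id` on every series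
  have hτσ : ∀ G : MvPowerSeries (Fin (m + 1)) k, subst (shear i (-φ)) (subst (shear i φ) G) = G := by
    intro G
    rw [subst_comp_subst_apply hσ hτ]
    have hfam : (fun l => subst (shear i (-φ)) (shear i φ l)) = fun l => (X l : MvPowerSeries (Fin (m + 1)) k) := by
      funext l
      have := subst_shear_shear_neg (φ := -φ) hφ' l
      rwa [neg_neg] at this
    rw [hfam]; exact congrFun subst_self G
  have hστ : ∀ G : MvPowerSeries (Fin (m + 1)) k, subst (shear i φ) (subst (shear i (-φ)) G) = G := by
    intro G
    rw [subst_comp_subst_apply hτ hσ]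
    have hfam : (fun l => subst (shear i φ) (shear i (-φ) l)) = fun l => (X l : MvPowerSeries (Fin (m + 1)) k) :=
      funext fun l => subst_shear_shear_neg hφ l
    rw [hfam]; exact congrFun subst_self G
  have hX := MvPowerSeries.prime_X' k j
  refine ⟨?_, ?_, ?_⟩
  · -- non-zero: the coefficient of `x_j` is `1`
    intro h0
    have h1 := congrArg (coeff (Finsupp.single j 1)) h0
    have hne : ¬ (Finsupp.single j 1 : Fin (m + 1) →₀ ℕ) = Finsupp.single i ((Finsupp.single j 1 : Fin (m + 1) →₀ ℕ) i) := by
      intro heq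
      have h2 := congrArg (fun E : Fin (m + 1) →₀ ℕ => E j) heq
      simp only [Finsupp.single_eq_same] at h2
      rw [Finsupp.single_apply, if_neg hij] at h2
      exact one_ne_zero h2
    rw [map_sub, coeff_X, if_pos rfl, coeff_onLetter, if_neg hne, sub_zero, map_zero] at h1
    exact one_ne_zero h1
  · -- not a unit: constant coefficient zero
    intro hu
    have h1 := hu.map (constantCoeff : MvPowerSeries (Fin (m + 1)) k →+* k)
    rw [map_sub, constantCoeff_X, constantCoeff_onLetter, hh, sub_zero] at h1
    exact not_isUnit_zero h1
  · -- divides a product ⇒ divides a factor: transport through `τ` to the letter `x_j`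
    intro a b hab
    have hab' : (X j : MvPowerSeries (Fin (m + 1)) k) ∣ subst (shear i (-φ)) a * subst (shear i (-φ)) b := by
      obtain ⟨q, hq⟩ := hab
      refine ⟨subst (shear i (-φ)) q, ?_⟩
      have := congrArg (subst (shear i (-φ))) hq
      rw [← coe_substAlgHom hτ, map_mul, map_mul, coe_substAlgHom, ← hF] at this
      have hXj : subst (shear i (-φ)) (shear i φ j) = X j := by
        have := subst_shear_shear_neg (φ := -φ) hφ' j
        rwa [neg_neg] at this
      rw [hXj] at this
      exact this
    rcases hX.dvd_or_dvd hab' with hdvd | hdvd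
    · left
      obtain ⟨q, hq⟩ := hdvd
      refine ⟨subst (shear i φ) q, ?_⟩
      have := congrArg (subst (shear i φ)) hq
      rw [hστ, ← coe_substAlgHom hσ, map_mul, coe_substAlgHom, subst_X hσ, hF] at this
      exact this
    · right
      obtain ⟨q, hq⟩ := hdvd
      refine ⟨subst (shear i φ) q, ?_⟩
      have := congrArg (subst (shear i φ)) hq
      rw [hστ, ← coe_substAlgHom hσ, map_mul, coe_substAlgHom, subst_X hσ, hF] at this
      exact this

/-- **DISTINCT GRAPHS GIVE NON-ASSOCIATED BINOMIALS.** -/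
theorem eq_of_associated_X_sub_onLetter {i j : Fin (m + 1)} (hij : i ≠ j) {h h' : PowerSeries k}
    (hh' : PowerSeries.constantCoeff h' = 0) (hass : Associated (X j - onLetter i h : MvPowerSeries (Fin (m + 1)) k) (X j - onLetter i h')) :
    h = h' := by
  obtain ⟨u, hu⟩ := hass
  -- kill the graph `h′`: the right side dies, so `h′(x_i) − h(x_i)` times a unit vanishes
  have hs := hasSubst_kill (i := i) (j := j) h' hh'
  have h1 := congrArg (subst (fun l : Fin (m + 1) => if l = j then onLetter i h' else (X l : MvPowerSeries (Fin (m + 1)) k))) hu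
  rw [← coe_substAlgHom hs, map_mul, coe_substAlgHom, subst_kill_X_sub_onLetter' hij h h' hh', subst_kill_X_sub_onLetter hij h' hh'] at h1
  have hunit : IsUnit (subst (fun l : Fin (m + 1) => if l = j then onLetter i h' else (X l : MvPowerSeries (Fin (m + 1)) k)) (u : MvPowerSeries (Fin (m + 1)) k)) := by
    rw [← coe_substAlgHom hs]; exact (Units.isUnit u).map _
  have h2 : onLetter i h' - onLetter i h = 0 := by
    rcases mul_eq_zero.mp h1 with h2 | h2
    · exact h2
    · exact absurd h2 hunit.ne_zero
  exact (onLetter_injective i (sub_eq_zero.mp h2)).symm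

/-! ## Finiteness -/

/-- **FINITELY MANY GRAPH BRANCHES DIVIDE A NON-ZERO SERIES** (OURS · L1 W4.3; (B1) of regime (P), graph form): for `A ≠ 0` in `k⟦x₀,…,x_m⟧` and
letters `i ≠ j`, the set of `h ∈ k⟦t⟧` with `h(0) = 0` and `(x_j − h(x_i)) ∣ A` is finite (each such prime is associated to a member of the finite
multiset `factors A`, and distinct graphs are non-associated). -/
theorem finite_graphs_dvd {i j : Fin (m + 1)} (hij : i ≠ j) {A : MvPowerSeries (Fin (m + 1)) k} (hA : A ≠ 0) :
    Set.Finite {h : PowerSeries k | PowerSeries.constantCoeff h = 0 ∧ (X j - onLetter i h) ∣ A} := by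
  classical
  haveI := uniqueFactorizationMonoid_mvPowerSeries (k := k) (m + 1)
  -- choose, for each admissible graph, an associated irreducible factor of `A`
  have hex : ∀ h : PowerSeries k, PowerSeries.constantCoeff h = 0 ∧ (X j - onLetter i h) ∣ A →
      ∃ q ∈ UniqueFactorizationMonoid.factors A, Associated (X j - onLetter i h) q := fun h hh =>
    UniqueFactorizationMonoid.exists_mem_factors_of_dvd hA (prime_X_sub_onLetter hij h hh.1).irreducible hh.2
  let f : PowerSeries k → MvPowerSeries (Fin (m + 1)) k := fun h =>
    if hh : PowerSeries.constantCoeff h = 0 ∧ (X j - onLetter i h) ∣ A then Classical.choose (hex h hh) else 0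
  have hf : ∀ h, ∀ hh : PowerSeries.constantCoeff h = 0 ∧ (X j - onLetter i h) ∣ A, f h = Classical.choose (hex h hh) :=
    fun h hh => dif_pos hh
  refine Set.Finite.of_finite_image (f := f) ?_ ?_
  · refine Set.Finite.subset (UniqueFactorizationMonoid.factors A).toFinset.finite_toSet ?_
    rintro q ⟨h, hh, rfl⟩
    rw [Finset.mem_coe, Multiset.mem_toFinset, hf h hh]
    exact (Classical.choose_spec (hex h hh)).1
  · intro h hh h' hh' heq
    rw [hf h hh, hf h' hh'] at heq
    have ha : Associated (X j - onLetter i h : MvPowerSeries (Fin (m + 1)) k) (X j - onLetter i h') := by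
      have h1 := (Classical.choose_spec (hex h hh)).2
      have h2 := (Classical.choose_spec (hex h' hh')).2
      rw [heq] at h1
      exact h1.trans h2.symm
    exact eq_of_associated_X_sub_onLetter hij hh'.1 ha

/-- **FINITELY MANY PERMISSIBLE GRAPH CURVES OF A LABEL** (OURS · L1 W4.3): for a family `A : Fin d → k⟦x⟧` with some `A_{j₀} ≠ 0`, the graphs
`h` (`h(0) = 0`) with `(x_j − h(x_i))^{d − l} ∣ A_l` for every `l` are finitely many. -/
theorem finite_graphs_dvd_pow_family {i j : Fin (m + 1)} (hij : i ≠ j) {d : ℕ} (A : Fin d → MvPowerSeries (Fin (m + 1)) k)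
    {j₀ : Fin d} (hA : A j₀ ≠ 0) :
    Set.Finite {h : PowerSeries k | PowerSeries.constantCoeff h = 0 ∧ ∀ l : Fin d, (X j - onLetter i h) ^ (d - (l : ℕ)) ∣ A l} := by
  refine (finite_graphs_dvd hij hA).subset ?_
  rintro h ⟨hh, hdvd⟩
  refine ⟨hh, ?_⟩
  have hd : 1 ≤ d - (j₀ : ℕ) := Nat.succ_le_of_lt (Nat.sub_pos_of_lt j₀.isLt)
  exact (dvd_pow_self _ (by omega)).trans ((pow_dvd_pow _ hd).trans (hdvd j₀))

end GraphCurve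

end TameFourTupleDrop

end Summit.ResolutionOfSingularities.ResolutionOfSingularities.Theorems

end
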